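import Summits.BirchSwinnertonDyer.BirchSwinnertonDyer.Theorems.CyclotomicUntwistDescendedFrobeniusTransferSemantics
import Summits.BirchSwinnertonDyer.BirchSwinnertonDyer.Theorems.CyclotomicUntwistNineIntegersStructure
import HarnessLib

/-!
# Route `CyclotomicUntwist`: the transfer semantics for EVERY good model over `𝓞_{ℚ₃(ζ₉)}` — the hypotheses
# «`E ≡ V₀ (mod ϖ)`, `3 ∣ ϖ⁶`» of `transfer_coboundary_integral` discharged with `ϖ = 1 − ζ₉` and the uniqueness of the
# residue map (`NineIntegers.ker_residueMap_eq`)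

Cell `pub/bsd-wall` (D-0145 line `route-BirchSwinnertonDyer-CyclotomicUntwist`), prover seat `bsd-line-cycu-p2`
(gen 6), lane «D5»; sequel of `…DescendedFrobeniusTransferSemantics` (this seat) using `…NineIntegersStructure`
(cycu-p4 g7, p629081: `ker ρ = 𝓞·(1 − ζ₉)`) and `…NineIntegers` (`θ ∈ 𝓞`, `ζ₉ ∈ 𝓞`) with `GNine.varpi_pow_six`
(cycu-p1: `(1 − ζ₉)⁶ = −3θ`). THEOREMS ONLY (no definition, no named fact, no `sorry`); helper `--supports` K1 =
stmt-BirchSwinnertonDyer-21580. BSD is not proved by this file and no crux is.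

* `three_dvd_one_sub_zeta_pow_six`: `3 ∣ (1 − ζ₉)⁶` in `𝓞` (witness `−θ`).
* `ringHom_padicInt_eq_toZMod`: a ring hom `ℤ₃ → 𝔽₃` is THE reduction map (its kernel contains `3`).
* `goodModel_congr_lift`: for a good model `𝓜`, a reduction map `ρ` and ANY `ℤ₃`-lift `V₀` of `𝓜.specialFibre ρ`:
  `𝓜.E ≡ V₀ ⊗ 𝓞 (mod 1 − ζ₉)` coefficientwise.
* **`transfer_coboundary_integral_goodModel`**: hence for every good model `𝓜`, lift `V₀` of its special fibre and
  `f ∈ ℚ₃⟦z⟧` with `n·[zⁿ]f ∈ ℤ₃` and `3ᴮ`-bounded `V̂₀`-coboundary, the coboundary of `f(z⁹)` for the GOOD MODEL's formal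
  group `𝓜.curve.formalGroupLaw` is `3ᴮ·𝓞`-integral coefficientwise — `[f(z⁹)] ∈ D(Ê/𝓞)_ℚ` with no side hypothesis: the
  transfer classes `log_{V₀}(z⁹)`, `log_{V₀}(z²⁷)` of `isDescendedFrobeniusMatrix_exists_of_transfer` are honest classes of
  the module on which the Literature predicate `IsDescendedFrobeniusMatrix` is read.
[cite: Katz1981CrystallineDieudonne, §5 Thm 5.1.4] [cite: BerthelotOgus1983, Thm. 2.4 (proof)]
-/

set_option autoImplicit false
-- single-conjunct summit: `Summit.BirchSwinnertonDyer.BirchSwinnertonDyer.…` repeats the name by design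
set_option linter.dupNamespace false

noncomputable section

open PowerSeries Literature.RingTheory.FormalGroups Literature.NumberTheory.EllipticCurves
  Literature.NumberTheory.EllipticCurves.DescendedFrobenius IsCyclotomicExtension
  Summit.BirchSwinnertonDyer.BirchSwinnertonDyer.Theorems.NineIntegers

namespace Summit.BirchSwinnertonDyer.BirchSwinnertonDyer.Theorems.DescendedFrobeniusTransfer

/-- **`3 ∣ (1 − ζ₉)⁶` in `𝓞`**: `(1 − ζ₉)⁶ = 3·(−θ)`, `θ = 1 − 3ϖ + 6ϖ² − 7ϖ³ + 5ϖ⁴ − 2ϖ⁵ ∈ 𝓞` (Washington, Lemma 1.4).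
[folklore] -/
theorem three_dvd_one_sub_zeta_pow_six :
    (3 : ONine) ∣ (⟨1 - zeta 9 ℚ_[3] KNine, one_sub_zeta_mem⟩ : ONine) ^ 6 := by
  refine ⟨-⟨_, theta_mem⟩, Subtype.ext ?_⟩
  have h := Summit.BirchSwinnertonDyer.BirchSwinnertonDyer.Theorems.GNine.varpi_pow_six zeta_spec
  push_cast
  linear_combination h

/-- **A ring hom `ℤ₃ → 𝔽₃` is the reduction map** (`x = n + 3y` with `n = (x mod 3).val`). [folklore] -/
theorem ringHom_padicInt_eq_toZMod (φ : ℤ_[3] →+* ZMod 3) : φ = PadicInt.toZMod := by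
  ext x
  have hx : x - ((PadicInt.toZMod x).val : ℤ_[3]) ∈ RingHom.ker (PadicInt.toZMod (p := 3)) := by
    rw [RingHom.mem_ker, map_sub, map_natCast, ZMod.natCast_zmod_val, sub_self]
  rw [PadicInt.ker_toZMod, PadicInt.maximalIdeal_eq_span_p, Ideal.mem_span_singleton] at hx
  obtain ⟨y, hy⟩ := hx
  have e : x = ((PadicInt.toZMod x).val : ℤ_[3]) + ((3 : ℕ) : ℤ_[3]) * y := by rw [← hy]; ring
  have h3 : φ ((3 : ℕ) : ℤ_[3]) = 0 := by rw [map_natCast]; decide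
  conv_lhs => rw [e]
  rw [map_add, map_mul, h3, zero_mul, add_zero, map_natCast, ZMod.natCast_zmod_val]

/-- **The good model is congruent to any `ℤ₃`-lift of its special fibre modulo `1 − ζ₉`**: with `ρ : 𝓞 → 𝔽₃` and
`V₀ mod 3 = 𝓜.specialFibre ρ`, each `aᵢ(𝓜.E) − aᵢ(V₀) ∈ ker ρ = 𝓞·(1 − ζ₉)` (`NineIntegers.ker_residueMap_eq`,
`ringHom_padicInt_eq_toZMod`). [folklore] -/
theorem goodModel_congr_lift {W : WeierstrassCurve ℚ} (𝓜 : W.NineGoodModel) (ρ : ONine →+* ZMod 3)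
    {V₀ : WeierstrassCurve ℤ_[3]} (hV : V₀.map PadicInt.toZMod = 𝓜.specialFibre ρ) :
    𝓜.E.map (Ideal.Quotient.mk (Ideal.span {(⟨1 - zeta 9 ℚ_[3] KNine, one_sub_zeta_mem⟩ : ONine)})) =
      (V₀.map (algebraMap ℤ_[3] ONine)).map
        (Ideal.Quotient.mk (Ideal.span {(⟨1 - zeta 9 ℚ_[3] KNine, one_sub_zeta_mem⟩ : ONine)})) := by
  set I : Ideal ONine := Ideal.span {(⟨1 - zeta 9 ℚ_[3] KNine, one_sub_zeta_mem⟩ : ONine)} with hI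
  have hker : RingHom.ker ρ = I := ker_residueMap_eq ρ
  have hρ : ρ.comp (algebraMap ℤ_[3] ONine) = PadicInt.toZMod := ringHom_padicInt_eq_toZMod _
  -- congruence of each coefficient
  have key : ∀ (x : ONine) (y : ℤ_[3]), ρ x = PadicInt.toZMod y →
      Ideal.Quotient.mk I x = Ideal.Quotient.mk I (algebraMap ℤ_[3] ONine y) := by
    intro x y h
    rw [Ideal.Quotient.eq, ← hker, RingHom.mem_ker, map_sub, h, ← hρ, RingHom.comp_apply, sub_self]
  have h1 := congrArg WeierstrassCurve.a₁ hV
  have h2 := congrArg WeierstrassCurve.a₂ hV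
  have h3 := congrArg WeierstrassCurve.a₃ hV
  have h4 := congrArg WeierstrassCurve.a₄ hV
  have h6 := congrArg WeierstrassCurve.a₆ hV
  simp only [WeierstrassCurve.map, WeierstrassCurve.NineGoodModel.specialFibre] at h1 h2 h3 h4 h6
  ext <;> simp only [WeierstrassCurve.map]
  · exact key _ _ h1.symm
  · exact key _ _ h2.symm
  · exact key _ _ h3.symm
  · exact key _ _ h4.symm
  · exact key _ _ h6.symm

/-- **THE TRANSFER SEMANTICS FOR EVERY GOOD MODEL.** For a good model `𝓜` of `W` over `𝓞_{ℚ₃(ζ₉)}`, a reduction map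
`ρ`, any `ℤ₃`-lift `V₀` of `𝓜.specialFibre ρ`, and `f ∈ ℚ₃⟦z⟧` with `n·[zⁿ]f ∈ ℤ₃` whose `V̂₀`-coboundary has coefficients
of norm `≤ 3ᴮ`: the coboundary of `f(z⁹)` for the good model's formal group (`𝓜.curve.formalGroupLaw`) is
`3ᴮ·𝓞`-integral coefficientwise, i.e. `[f(z⁹)] ∈ D(Ê/𝓞)_ℚ`. Applied to `f = log_{V₀}` and `f = log_{V₀}(z³)` (second
kind for `V̂₀`: `SecondKindFrobenius.secondKind_expand_pow_formalLog`): the transfer basis is honest.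
[cite: Katz1981CrystallineDieudonne, §5 Thm 5.1.4] [cite: BerthelotOgus1983, Thm. 2.4 (proof)] -/
theorem transfer_coboundary_integral_goodModel {W : WeierstrassCurve ℚ} (𝓜 : W.NineGoodModel)
    (ρ : ONine →+* ZMod 3) {V₀ : WeierstrassCurve ℤ_[3]} (hV : V₀.map PadicInt.toZMod = 𝓜.specialFibre ρ)
    {f : ℚ_[3]⟦X⟧} (hf : ∀ n : ℕ, ‖(n : ℚ_[3]) * coeff n f‖ ≤ 1) {B : ℕ}
    (hcob : ∀ d, ‖MvPowerSeries.coeff d (f.subst (V₀.map PadicInt.Coe.ringHom).formalGroupLaw -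
      f.subst (MvPowerSeries.X 0) - f.subst (MvPowerSeries.X 1))‖ ≤ (3 : ℝ) ^ B) (d : Fin 2 →₀ ℕ) :
    IsIntegral ℤ_[3] ((3 : KNine) ^ B * MvPowerSeries.coeff d
      ((expand 9 (by norm_num) (f.map (algebraMap ℚ_[3] KNine))).subst 𝓜.curve.formalGroupLaw -
        (expand 9 (by norm_num) (f.map (algebraMap ℚ_[3] KNine))).subst (MvPowerSeries.X 0) -
        (expand 9 (by norm_num) (f.map (algebraMap ℚ_[3] KNine))).subst (MvPowerSeries.X 1))) :=
  transfer_coboundary_integral three_dvd_one_sub_zeta_pow_six (goodModel_congr_lift 𝓜 ρ hV) hf hcob d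

/-- **In particular for the logarithm of the lift**: `[log_{V₀}(z⁹)]` — the first transfer class `ℓ₀` — lies in
`D(Ê/𝓞)_ℚ` with coboundary `3⁻¹·𝓞`-integral (`B = 1`: the coboundary of `log_{V₀}` is `0`, of `log_{V₀}(z⁹)` is
`3⁻¹`-bounded by `secondKind_expand_pow_formalLog` — here read with the generous bound `3¹`).
[cite: Katz1981CrystallineDieudonne, §5 Thm 5.1.4] -/
theorem formalLog_transfer_coboundary_integral {W : WeierstrassCurve ℚ} (𝓜 : W.NineGoodModel)
    (ρ : ONine →+* ZMod 3) {V₀ : WeierstrassCurve ℤ_[3]} (hV : V₀.map PadicInt.toZMod = 𝓜.specialFibre ρ)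
    (d : Fin 2 →₀ ℕ) :
    IsIntegral ℤ_[3] ((3 : KNine) ^ 0 * MvPowerSeries.coeff d
      ((expand 9 (by norm_num) ((V₀.map PadicInt.Coe.ringHom).formalLog.map (algebraMap ℚ_[3] KNine))).subst
          𝓜.curve.formalGroupLaw -
        (expand 9 (by norm_num) ((V₀.map PadicInt.Coe.ringHom).formalLog.map (algebraMap ℚ_[3] KNine))).subst
          (MvPowerSeries.X 0) -
        (expand 9 (by norm_num) ((V₀.map PadicInt.Coe.ringHom).formalLog.map (algebraMap ℚ_[3] KNine))).subst
          (MvPowerSeries.X 1))) := by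
  haveI : (V₀.map PadicInt.Coe.ringHom).IsIntegral ℤ_[3] := V₀.isIntegral_map_coe
  refine transfer_coboundary_integral_goodModel 𝓜 ρ hV
    ((V₀.map PadicInt.Coe.ringHom).norm_natCast_mul_coeff_formalLog_le) (fun e ↦ ?_) d
  rw [SecondKindFrobenius.coboundary_formalLog_eq_zero, MvPowerSeries.coeff_zero, norm_zero, pow_zero]
  exact zero_le_one

end Summit.BirchSwinnertonDyer.BirchSwinnertonDyer.Theorems.DescendedFrobeniusTransfer
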